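import Mathlib
import HarnessLib
import Summits.Ventures.LatticeQCDFlow.Exactness.SU2ExactForceWilson

/-!
# The engine's LO Wilson-flow sub-step IS one explicit Euler step of the gradient flow of `S_W` in the HMC drift coordinates: `U' = exp(c P_ℓ)·U` at momentum `p_ℓ = −ε·m_ℓ`, `m_ℓ` the Wilson force routine (`κ = 1`) = the exact gradient of `β·S_W` over `2βc`

HONEST FRAMING: exact (Metropolis-corrected) sampling algorithms for lattice gauge theory;
figures of merit are autocorrelation/cost numbers at stated couplings and volumes; no
continuum-physics claim.

Venture `LatticeQCDFlow` (cell pub-lqcd), topic `Exactness`; FANOUT row 14 (`eng-flowhmc`; member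
`maps.wilson_flow_lo`: at every active link the kick `U ↦ gaussUnit (geodesicKick ε J_ℓ (vecQuat U))`
towards the conjugate staple sum `J_ℓ`; HMC drift `U_ℓ ← exp(c P_ℓ) U_ℓ`, `P_ℓ = quatVec (0, c p_ℓ)`).
NEW WORK of the cell; nothing is cited as a fact; no number.  GEN-8's `coe_su2Substep_eq_exp_mul`
wrote the kick as `exp(−ε·P(U R))·U` (`R = (quatVec J)ᴴ`, `P` the anti-Hermitian part) and GEN-7's
`SU2WilsonFlowLOExponential` SAID in prose that this is "steepest descent of the plaquette action";
`SU2ExactForceWilson` (this GEN) identified the Wilson routine `m_ℓ = vecQuat (U_ℓ R_ℓ) ∘ succ` with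
the exact gradient of `β·S_W` along the drift (`κ·∇ = (2βcκ)·m`).  Put together:

* `quatVec_im_vecQuat` — for a quaternion `M`, `quatVec (0, m₁, m₂, m₃) = ½ (M − Mᴴ)`, `m = vecQuat M`
  (the drift generator with the pure part of `M` as momentum IS the engine's projection `P(M)`);
* **`coe_su2Substep_eq_su2Drift_wilsonForce`** — for every `U ∈ SU(2)`, `J`, `ε`: the kick equals the
  HMC drift factor at momentum MINUS `ε` times the Wilson routine,
  `gaussUnit (geodesicKick ε J (vecQuat U)) = exp (quatVec (0, −ε m₁, −ε m₂, −ε m₃)) · U`,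
  `m = vecQuat (U (quatVec J)ᴴ)` — one explicit Euler step of size `ε` DOWN the Wilson force routine;
* **`coe_su2Substep_eq_su2Drift_exactForce`** — hence, for `L ≥ 2`, `β c κ ≠ 0` and the conjugate
  staple field `J_ℓ(V)` of the LO member (formula VERBATIM): the kick at the link `ℓ` of the field `V` is
  the drift `exp(c P_ℓ)·V_ℓ` evaluated at the momentum `p = −(ε / (2βc²κ)) · (κ·∇_p (β S_W(exp(c p)·V)))(0)`
  — THE ZERO-PARAMETER MEMBER MOVES EACH ACTIVE LINK BY ONE EULER STEP OF THE GRADIENT FLOW OF `S_W`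
  (Lüscher's `V̇ = −∂S·V`, eq. (1.4) of the flow paper, in the engine's coordinates; the factor `2`
  is `−Re tr (E_i E_j) = 2δ_ij`).

NOT CLAIMED: the masked/frozen-field bookkeeping of a whole sub-step (the identity is per link, for
the field the sub-step reads); the normalisation of `ε` against Lüscher's flow time `t` beyond this
identity; `L = 1`; `SU(N ≥ 3)`; any number.
-/

noncomputable section

namespace Summit.Ventures.LatticeQCDFlow.Exactness

open WithLp NormedSpace InnerProductGeometry
open Literature.MathematicalPhysics.QuantumFieldTheory Summit.Ventures.LatticeQCDFlow.Scoring
open scoped Matrix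

variable {d L : ℕ}

/-- `quatVec (0, m₁, m₂, m₃) = ½ (M − Mᴴ)` for a quaternion `M` with coordinates `m = vecQuat M`: the
drift generator at momentum `Im m` is the anti-Hermitian (here automatically traceless) part of `M`. -/
theorem quatVec_im_vecQuat {M : Matrix (Fin 2) (Fin 2) ℂ} (hM : IsQuat M) :
    quatVec (toLp 2 ![0, vecQuat M 1, vecQuat M 2, vecQuat M 3]) = (1 / 2 : ℂ) • (M - Mᴴ) := by
  rw [quatVec_im_eq_half_sub_conjTranspose (vecQuat M), quatVec_vecQuat hM]

/-- **The LO Wilson-flow kick IS the HMC drift at momentum `−ε ·` (Wilson force routine, `κ = 1`).**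
For every `U ∈ SU(2)`, `J ∈ ℝ⁴`, `ε`:  `gaussUnit (geodesicKick ε J (vecQuat U)) = exp (quatVec (0, −ε m)) · U`
with `m = (vecQuat (U (quatVec J)ᴴ) 1, 2, 3)`. -/
theorem coe_su2Substep_eq_su2Drift_wilsonForce (U : (Matrix.specialUnitaryGroup (Fin 2) ℂ)) (J : R4) (ε : ℝ) :
    ((gaussUnit (geodesicKick ε J (vecQuat (U : Matrix (Fin 2) (Fin 2) ℂ))) : (Matrix.specialUnitaryGroup (Fin 2) ℂ)) : Matrix (Fin 2) (Fin 2) ℂ) =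
      exp (quatVec (toLp 2 ![0, -ε * vecQuat ((U : Matrix (Fin 2) (Fin 2) ℂ) * (quatVec J)ᴴ) 1, -ε * vecQuat ((U : Matrix (Fin 2) (Fin 2) ℂ) * (quatVec J)ᴴ) 2,
        -ε * vecQuat ((U : Matrix (Fin 2) (Fin 2) ℂ) * (quatVec J)ᴴ) 3])) * (U : Matrix (Fin 2) (Fin 2) ℂ) := by
  have hM : IsQuat ((U : Matrix (Fin 2) (Fin 2) ℂ) * (quatVec J)ᴴ) :=
    (IsQuat.of_mem_specialUnitaryGroup U.2).mul (isQuat_quatVec J).conjTranspose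
  have h1 : (toLp 2 ![0, -ε * vecQuat ((U : Matrix (Fin 2) (Fin 2) ℂ) * (quatVec J)ᴴ) 1, -ε * vecQuat ((U : Matrix (Fin 2) (Fin 2) ℂ) * (quatVec J)ᴴ) 2,
        -ε * vecQuat ((U : Matrix (Fin 2) (Fin 2) ℂ) * (quatVec J)ᴴ) 3] : R4) =
      (-ε) • (toLp 2 ![0, vecQuat ((U : Matrix (Fin 2) (Fin 2) ℂ) * (quatVec J)ᴴ) 1, vecQuat ((U : Matrix (Fin 2) (Fin 2) ℂ) * (quatVec J)ᴴ) 2,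
        vecQuat ((U : Matrix (Fin 2) (Fin 2) ℂ) * (quatVec J)ᴴ) 3] : R4) := by
    ext k
    fin_cases k <;> simp
  have hconj : quatVec J * (U : Matrix (Fin 2) (Fin 2) ℂ)ᴴ = (((U : Matrix (Fin 2) (Fin 2) ℂ) * (quatVec J)ᴴ))ᴴ := by
    rw [Matrix.conjTranspose_mul, Matrix.conjTranspose_conjTranspose]
  rw [coe_su2Substep_eq_exp_mul, h1, quatVec_smul, quatVec_im_vecQuat hM, hconj,
    Matrix.conjTranspose_conjTranspose, smul_smul]
  congr 2
  rw [← neg_sub ((((U : Matrix (Fin 2) (Fin 2) ℂ) * (quatVec J)ᴴ))ᴴ), smul_neg, ← neg_smul]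
  congr 1
  push_cast
  ring

variable [NeZero L]

/-- **The LO Wilson-flow kick is one explicit Euler step of the GRADIENT FLOW of `S_W`** in the HMC
drift coordinates: for `L ≥ 2`, `β c κ ≠ 0`, every field `V`, link `ℓ` and kick parameter `ε`, the kick
of `V_ℓ` towards its conjugate staple sum `J_ℓ(V)` (formula VERBATIM as in the LO member) equals
`exp (quatVec (0, c p)) · V_ℓ` at `p = −(ε/(2βc²κ)) · (exact-gradient force of β·S_W at V)(ℓ, ·)`. -/
theorem coe_su2Substep_eq_su2Drift_exactForce (hL : 2 ≤ L) {β c κ : ℝ} (hβ : β ≠ 0) (hc : c ≠ 0)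
    (hκ : κ ≠ 0) (ε : ℝ) (V : GaugeConfig d L (Matrix.specialUnitaryGroup (Fin 2) ℂ)) (ℓ : Edge d L) :
    ((gaussUnit (geodesicKick ε (∑ ν ∈ Finset.univ.erase ℓ.2,
            (vecQuat (((V (Site.shift ℓ.1 ℓ.2, ν) * (V (Site.shift ℓ.1 ν, ℓ.2))⁻¹ * (V (ℓ.1, ν))⁻¹)⁻¹ : (Matrix.specialUnitaryGroup (Fin 2) ℂ)) : Matrix (Fin 2) (Fin 2) ℂ) +
              vecQuat ((((V (Site.shift (ℓ.1 - Pi.single ν 1) ℓ.2, ν))⁻¹ * (V (ℓ.1 - Pi.single ν 1, ℓ.2))⁻¹ *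
                V (ℓ.1 - Pi.single ν 1, ν))⁻¹ : (Matrix.specialUnitaryGroup (Fin 2) ℂ)) : Matrix (Fin 2) (Fin 2) ℂ)))
        (vecQuat ((V ℓ : (Matrix.specialUnitaryGroup (Fin 2) ℂ)) : Matrix (Fin 2) (Fin 2) ℂ))) : (Matrix.specialUnitaryGroup (Fin 2) ℂ)) : Matrix (Fin 2) (Fin 2) ℂ) =
      exp (quatVec (toLp 2 ![0,
        c * (-(ε / (2 * β * c ^ 2 * κ)) * (fun q : Edge d L × Fin 3 => κ * fderiv ℝ (fun p : ((Edge d L × Fin 3) → ℝ) => (fun W : GaugeConfig d L (Matrix.specialUnitaryGroup (Fin 2) ℂ) => β * wilsonAction (Matrix.specialUnitaryGroup (Fin 2) ℂ).subtype W) ((fun ℓ : Edge d L => gaussUnit (toLp 2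
          ![Real.cos (c * Real.sqrt (p (ℓ, 0) ^ 2 + p (ℓ, 1) ^ 2 + p (ℓ, 2) ^ 2)),
            c * Real.sinc (c * Real.sqrt (p (ℓ, 0) ^ 2 + p (ℓ, 1) ^ 2 + p (ℓ, 2) ^ 2)) * p (ℓ, 0),
            c * Real.sinc (c * Real.sqrt (p (ℓ, 0) ^ 2 + p (ℓ, 1) ^ 2 + p (ℓ, 2) ^ 2)) * p (ℓ, 1),
            c * Real.sinc (c * Real.sqrt (p (ℓ, 0) ^ 2 + p (ℓ, 1) ^ 2 + p (ℓ, 2) ^ 2)) * p (ℓ, 2)])) * V)) 0 (Pi.single q 1)) (ℓ, 0)),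
        c * (-(ε / (2 * β * c ^ 2 * κ)) * (fun q : Edge d L × Fin 3 => κ * fderiv ℝ (fun p : ((Edge d L × Fin 3) → ℝ) => (fun W : GaugeConfig d L (Matrix.specialUnitaryGroup (Fin 2) ℂ) => β * wilsonAction (Matrix.specialUnitaryGroup (Fin 2) ℂ).subtype W) ((fun ℓ : Edge d L => gaussUnit (toLp 2
          ![Real.cos (c * Real.sqrt (p (ℓ, 0) ^ 2 + p (ℓ, 1) ^ 2 + p (ℓ, 2) ^ 2)),
            c * Real.sinc (c * Real.sqrt (p (ℓ, 0) ^ 2 + p (ℓ, 1) ^ 2 + p (ℓ, 2) ^ 2)) * p (ℓ, 0),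
            c * Real.sinc (c * Real.sqrt (p (ℓ, 0) ^ 2 + p (ℓ, 1) ^ 2 + p (ℓ, 2) ^ 2)) * p (ℓ, 1),
            c * Real.sinc (c * Real.sqrt (p (ℓ, 0) ^ 2 + p (ℓ, 1) ^ 2 + p (ℓ, 2) ^ 2)) * p (ℓ, 2)])) * V)) 0 (Pi.single q 1)) (ℓ, 1)),
        c * (-(ε / (2 * β * c ^ 2 * κ)) * (fun q : Edge d L × Fin 3 => κ * fderiv ℝ (fun p : ((Edge d L × Fin 3) → ℝ) => (fun W : GaugeConfig d L (Matrix.specialUnitaryGroup (Fin 2) ℂ) => β * wilsonAction (Matrix.specialUnitaryGroup (Fin 2) ℂ).subtype W) ((fun ℓ : Edge d L => gaussUnit (toLp 2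
          ![Real.cos (c * Real.sqrt (p (ℓ, 0) ^ 2 + p (ℓ, 1) ^ 2 + p (ℓ, 2) ^ 2)),
            c * Real.sinc (c * Real.sqrt (p (ℓ, 0) ^ 2 + p (ℓ, 1) ^ 2 + p (ℓ, 2) ^ 2)) * p (ℓ, 0),
            c * Real.sinc (c * Real.sqrt (p (ℓ, 0) ^ 2 + p (ℓ, 1) ^ 2 + p (ℓ, 2) ^ 2)) * p (ℓ, 1),
            c * Real.sinc (c * Real.sqrt (p (ℓ, 0) ^ 2 + p (ℓ, 1) ^ 2 + p (ℓ, 2) ^ 2)) * p (ℓ, 2)])) * V)) 0 (Pi.single q 1)) (ℓ, 2))])) * ((V ℓ : (Matrix.specialUnitaryGroup (Fin 2) ℂ)) : Matrix (Fin 2) (Fin 2) ℂ) := by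
  rw [su2ExactForce_wilson hL β c κ V, coe_su2Substep_eq_su2Drift_wilsonForce]
  congr 3
  ext k
  fin_cases k <;> simp <;> field_simp

end Summit.Ventures.LatticeQCDFlow.Exactness
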